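import Mathlib
import Summits.Schanuel.Schanuel.Theorems.AclSubsetLogFreeCore.Negative.LogFreeCoreObjects
import Literature.NumberTheory.Transcendental.ZilberThm15
import Literature.NumberTheory.Transcendental.ZilberFieldQuasiminimalProofs
import Literature.NumberTheory.Transcendental.GammaIsoTwistedTransfer
import Literature.ModelTheory.Quasiminimal.PregeometryStructures

/-!
# Crux `RigidCore.AclSubsetLogFreeCore` (stmt-Schanuel-0968), line `eac-extends-core-automorphisms`: stub `stub_coreAut_elementary_of_eac`

Under Zilber's exponential-algebraic closedness of `ℂ_exp` (EAC, a HYPOTHESIS here), every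
exponential-field automorphism `g` of the countable core `C₀ = ecl ∅` (tree presentation
`IsEIsoOn g (ecl ∅) (ecl ∅)`) preserves the trace on `C₀` of every `∅`-definable subset of
`(ℂ, +, ·, −, 0, 1, exp)`: for `a ∈ ecl ∅`, `a ∈ s ↔ g a ∈ s`.

Proof: Karp's lemma (`FirstOrder.Language.realize_iff_of_isBackAndForth`) for the back-and-forth
system of *twisted* Γ-isomorphisms (`GammaField.IsGammaIsoTw`) over the isomorphism of base
Γ-fields `σ = ZilberHomogeneity.baseEquiv hg : K⁰ ≃ K⁰`, `K = span ℚ (ecl ∅)` (Γ-closed,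
countable), between finite tuples spanning strong extensions of `K` inside the one field `ℂ`:
* `exists_extension_tw_complex` — one-point extension over any isomorphism `τ` of `K⁰` (used for
  `σ` and `σ⁻¹`): Γ-algebraic points by `ZilberHomogeneity.exists_forth_tw` (twisted
  `ℵ₀`-saturation from generic strong Γ-closedness over `K`, which EAC gives over `ℂ`:
  `GammaField.isGenericallyStronglyGammaClosedOver_complex_of_isExpAlgClosed`), generic points by
  `GammaField.IsGammaIsoTw.append_singleton_of_not_mem` (a partner outside the countable Γ-closed
  `ecl (K ∪ c')` exists: `ℂ` is uncountable, `hasCountableClosureProperty_complex_holds`);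
* `exists_state_realize_term_tw`, `isBackAndForth_gammaIsoTw` — twisted port of the tree's
  `GammaField.exists_state_realize_term_of_extension` / `isBackAndForth_gammaIso_of_extension`
  (`ZilberFieldQuasiminimalProps.lean`; the defining relations of term values have integer
  coefficients, so they are their own `σ`-transports and transfer at level `0`);
* start: the empty state (`ZilberHomogeneity.isGammaIsoTw_elim0`) extended by the base constant
  `a ∈ K⁰`, whose partner is forced to be `σ a = g a` (`IsGammaIsoTw.eq_of_eq_coe`,
  `ZilberHomogeneity.coe_baseEquiv`).

References: J. Kirby, *On quasiminimal excellent classes*, JSL 75 (2010), Thm 2.1 (proof);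
M. Bays, J. Kirby, *Pseudo-exponential maps, variants, and quasiminimality*, ANT 12 (2018),
Thm 6.9 (proof), Prop. 11.2, Thm 11.6 (proof).
-/

noncomputable section

set_option linter.dupNamespace false

open FirstOrder FirstOrder.Language Set
open Literature.ModelTheory.ExponentialFields
open Literature.NumberTheory.Transcendental
open Summit.Schanuel.Schanuel.Theorems.AclSubsetLogFreeCore.Negative

namespace Summit.Schanuel.Schanuel.Theorems.RigidCore

open GammaField ZilberHomogeneity Literature.ModelTheory.ExponentialFields.ExponentialRing

/-! ### Karp's lemma for twisted Γ-isomorphisms, granted the one-point extension property -/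

section Karp

variable {F : Type*} [Field F] [CharZero F] [ExponentialRing F]
  {K₁ K₂ : Submodule ℚ F} {σ : fieldOf K₁ ≃+* fieldOf K₂}
  (hext : ∀ {N : ℕ} {c c' : Fin N → F}, IsGammaIsoTw σ c c' →
    IsStrong (K₁ ⊔ Submodule.span ℚ (range c)) → IsStrong (K₂ ⊔ Submodule.span ℚ (range c')) →
    ∀ d : F, ∃ (k : ℕ) (e e' : Fin (k + 1) → F), e 0 = d ∧
      IsGammaIsoTw σ (Fin.append c e) (Fin.append c' e') ∧
      IsStrong (K₁ ⊔ Submodule.span ℚ (range (Fin.append c e))) ∧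
      IsStrong (K₂ ⊔ Submodule.span ℚ (range (Fin.append c' e'))))

include hext

/-- **Values of terms are captured by extended twisted states** (twisted port of
`GammaField.exists_state_realize_term_of_extension`). Given a twisted Γ-isomorphism `c ↦ c'`
over `σ` between tuples generating strong subspaces over `K₁`, `K₂`, whose coordinates cover the
valuations `(v, xs)` and `(v', ys)`, and an `L_exp`-term `t`, some extension (granted the one-point
extension property `hext`) has a coordinate carrying `t(v, xs)` on the left and `t(v', ys)` on the
right: induction on `t`; the new right-hand coordinate is forced by the linear / monomial /
exponential relation defining it, a level-`0` relation with integer coefficients, hence equal to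
its own `σ`-transport. -/
theorem exists_state_realize_term_tw {α : Type*} {n : ℕ}
    (t : Language.expRing.Term (α ⊕ Fin n))
    {v v' : α → F} {xs ys : Fin n → F} {N : ℕ} {c c' : Fin N → F} (hiso : IsGammaIsoTw σ c c')
    (hs : IsStrong (K₁ ⊔ Submodule.span ℚ (range c)))
    (hs' : IsStrong (K₂ ⊔ Submodule.span ℚ (range c')))
    (hv : ∀ i, ∃ j, c j = v i ∧ c' j = v' i) (hx : ∀ i, ∃ j, c j = xs i ∧ c' j = ys i) :
    ∃ (N₁ : ℕ) (c₁ c₁' : Fin N₁ → F), IsGammaIsoTw σ c₁ c₁' ∧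
      IsStrong (K₁ ⊔ Submodule.span ℚ (range c₁)) ∧ IsStrong (K₂ ⊔ Submodule.span ℚ (range c₁')) ∧
      (∀ i, ∃ j, c₁ j = c i ∧ c₁' j = c' i) ∧
      ∃ j, c₁ j = t.realize (Sum.elim v xs) ∧ c₁' j = t.realize (Sum.elim v' ys) := by
  classical
  -- one extension step by a prescribed element, keeping track of the old coordinates
  have step : ∀ {N : ℕ} {c c' : Fin N → F}, IsGammaIsoTw σ c c' →
      IsStrong (K₁ ⊔ Submodule.span ℚ (range c)) → IsStrong (K₂ ⊔ Submodule.span ℚ (range c')) →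
      ∀ d : F, ∃ (N₁ : ℕ) (c₁ c₁' : Fin N₁ → F), IsGammaIsoTw σ c₁ c₁' ∧
        IsStrong (K₁ ⊔ Submodule.span ℚ (range c₁)) ∧
        IsStrong (K₂ ⊔ Submodule.span ℚ (range c₁')) ∧
        (∃ g : Fin N → Fin N₁, (∀ i, c₁ (g i) = c i) ∧ (∀ i, c₁' (g i) = c' i)) ∧
        ∃ j, c₁ j = d := by
    intro N c c' hiso hs hs' d
    obtain ⟨k, e, e', he0, hiso₁, hs₁, hs₁'⟩ := hext hiso hs hs' d
    refine ⟨N + (k + 1), Fin.append c e, Fin.append c' e', hiso₁, hs₁, hs₁',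
      ⟨Fin.castAdd (k + 1), fun i => Fin.append_left _ _ i, fun i => Fin.append_left _ _ i⟩,
      Fin.natAdd N 0, ?_⟩
    rw [Fin.append_right, he0]
  induction t generalizing N c c' with
  | var a =>
    refine ⟨N, c, c', hiso, hs, hs', fun i => ⟨i, rfl, rfl⟩, ?_⟩
    rcases a with i | i
    · obtain ⟨j, hj, hj'⟩ := hv i
      exact ⟨j, by rw [Term.realize_var, Sum.elim_inl, hj],
        by rw [Term.realize_var, Sum.elim_inl, hj']⟩
    · obtain ⟨j, hj, hj'⟩ := hx i
      exact ⟨j, by rw [Term.realize_var, Sum.elim_inr, hj],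
        by rw [Term.realize_var, Sum.elim_inr, hj']⟩
  | func f ts ih =>
    -- evaluate the arguments one after the other, threading the state
    have args : ∀ (m : ℕ) (hm : m ≤ _) , ∃ (N₁ : ℕ) (c₁ c₁' : Fin N₁ → F), IsGammaIsoTw σ c₁ c₁' ∧
        IsStrong (K₁ ⊔ Submodule.span ℚ (range c₁)) ∧
        IsStrong (K₂ ⊔ Submodule.span ℚ (range c₁')) ∧
        (∀ i, ∃ j, c₁ j = c i ∧ c₁' j = c' i) ∧
        ∀ l (hl : l < m), ∃ j, c₁ j = (ts ⟨l, lt_of_lt_of_le hl hm⟩).realize (Sum.elim v xs) ∧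
          c₁' j = (ts ⟨l, lt_of_lt_of_le hl hm⟩).realize (Sum.elim v' ys) := by
      intro m
      induction m with
      | zero =>
        intro _
        exact ⟨N, c, c', hiso, hs, hs', fun i => ⟨i, rfl, rfl⟩,
          fun l hl => (Nat.not_lt_zero l hl).elim⟩
      | succ m ihm =>
        intro hm
        obtain ⟨N₁, c₁, c₁', hiso₁, hs₁, hs₁', hcov₁, hval₁⟩ := ihm (Nat.le_of_succ_le hm)
        have hv₁ : ∀ i, ∃ j, c₁ j = v i ∧ c₁' j = v' i := fun i => by
          obtain ⟨j, hj, hj'⟩ := hv i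
          obtain ⟨j₁, h1, h1'⟩ := hcov₁ j
          exact ⟨j₁, h1.trans hj, h1'.trans hj'⟩
        have hx₁ : ∀ i, ∃ j, c₁ j = xs i ∧ c₁' j = ys i := fun i => by
          obtain ⟨j, hj, hj'⟩ := hx i
          obtain ⟨j₁, h1, h1'⟩ := hcov₁ j
          exact ⟨j₁, h1.trans hj, h1'.trans hj'⟩
        obtain ⟨N₂, c₂, c₂', hiso₂, hs₂, hs₂', hcov₂, j₂, hj₂, hj₂'⟩ :=
          ih ⟨m, hm⟩ hiso₁ hs₁ hs₁' hv₁ hx₁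
        refine ⟨N₂, c₂, c₂', hiso₂, hs₂, hs₂', fun i => ?_, fun l hl => ?_⟩
        · obtain ⟨j, hj, hj'⟩ := hcov₁ i
          obtain ⟨j', h1, h1'⟩ := hcov₂ j
          exact ⟨j', h1.trans hj, h1'.trans hj'⟩
        · rcases Nat.lt_succ_iff_lt_or_eq.1 hl with hl' | rfl
          · obtain ⟨j, hj, hj'⟩ := hval₁ l hl'
            obtain ⟨j', h1, h1'⟩ := hcov₂ j
            exact ⟨j', h1.trans hj, h1'.trans hj'⟩
          · exact ⟨j₂, hj₂, hj₂'⟩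
    obtain ⟨N₁, c₁, c₁', hiso₁, hs₁, hs₁', hcov₁, hval₁⟩ := args _ le_rfl
    -- the value of `func f ts`
    have hreal : ∀ (w : α ⊕ Fin n → F), (Term.func f ts).realize w =
        Structure.funMap f fun i => (ts i).realize w := fun w => rfl
    -- add the value on the left; the value on the right is then forced
    obtain ⟨N₂, c₂, c₂', hiso₂, hs₂, hs₂', ⟨g, hg, hg'⟩, j, hj⟩ :=
      step hiso₁ hs₁ hs₁' ((Term.func f ts).realize (Sum.elim v xs))
    refine ⟨N₂, c₂, c₂', hiso₂, hs₂, hs₂', fun i => ?_, j, hj, ?_⟩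
    · obtain ⟨j₁, h1, h1'⟩ := hcov₁ i
      exact ⟨g j₁, (hg j₁).trans h1, (hg' j₁).trans h1'⟩
    -- indices of the arguments in the final state
    have hargs : ∀ i : Fin _, ∃ j', c₂ j' = (ts i).realize (Sum.elim v xs) ∧
        c₂' j' = (ts i).realize (Sum.elim v' ys) := fun i => by
      obtain ⟨j₁, h1, h1'⟩ := hval₁ i.1 i.2
      exact ⟨g j₁, (hg j₁).trans h1, (hg' j₁).trans h1'⟩
    -- transfer the defining relation along the twisted Γ-isomorphism (level `0`)
    have transfer : ∀ P : MvPolynomial (Fin N₂ ⊕ Fin N₂) (fieldOf K₁),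
        MvPolynomial.aeval (lvGens 0 c₂) P = 0 →
          MvPolynomial.aeval (lvGens 0 c₂')
            (MvPolynomial.map (σ : fieldOf K₁ →+* fieldOf K₂) P) = 0 :=
      fun P h0 => (hiso₂ 0 P).1 h0
    cases f with
    | add =>
      obtain ⟨j₀, h0, h0'⟩ := hargs 0
      obtain ⟨j₁, h1, h1'⟩ := hargs 1
      have := transfer (MvPolynomial.X (Sum.inl j) - (MvPolynomial.X (Sum.inl j₀) +
        MvPolynomial.X (Sum.inl j₁))) (by simp [hj, hreal, h0, h1])
      simp only [map_sub, map_add, MvPolynomial.map_X, MvPolynomial.aeval_X, lvGens_inl,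
        sub_eq_zero] at this
      rw [this, hreal, Literature.ModelTheory.ExponentialFields.Language.expRing.funMap_add, h0', h1']
    | mul =>
      obtain ⟨j₀, h0, h0'⟩ := hargs 0
      obtain ⟨j₁, h1, h1'⟩ := hargs 1
      have := transfer (MvPolynomial.X (Sum.inl j) - (MvPolynomial.X (Sum.inl j₀) *
        MvPolynomial.X (Sum.inl j₁))) (by simp [hj, hreal, h0, h1])
      simp only [map_sub, map_mul, MvPolynomial.map_X, MvPolynomial.aeval_X, lvGens_inl,
        sub_eq_zero] at this
      rw [this, hreal, Literature.ModelTheory.ExponentialFields.Language.expRing.funMap_mul, h0', h1']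
    | neg =>
      obtain ⟨j₀, h0, h0'⟩ := hargs 0
      have := transfer (MvPolynomial.X (Sum.inl j) + MvPolynomial.X (Sum.inl j₀))
        (by simp [hj, hreal, h0])
      simp only [map_add, MvPolynomial.map_X, MvPolynomial.aeval_X, lvGens_inl,
        add_eq_zero_iff_eq_neg] at this
      rw [this, hreal, Literature.ModelTheory.ExponentialFields.Language.expRing.funMap_neg, h0']
    | zero =>
      have := transfer (MvPolynomial.X (Sum.inl j)) (by simp [hj, hreal])
      simp only [MvPolynomial.map_X, MvPolynomial.aeval_X, lvGens_inl] at this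
      rw [this, hreal, Literature.ModelTheory.ExponentialFields.Language.expRing.funMap_zero]
    | one =>
      have := transfer (MvPolynomial.X (Sum.inl j) - 1) (by simp [hj, hreal])
      simp only [map_sub, map_one, MvPolynomial.map_X, MvPolynomial.aeval_X, lvGens_inl,
        sub_eq_zero] at this
      rw [this, hreal, Literature.ModelTheory.ExponentialFields.Language.expRing.funMap_one]
    | exp =>
      obtain ⟨j₀, h0, h0'⟩ := hargs 0
      have := transfer (MvPolynomial.X (Sum.inl j) - MvPolynomial.X (Sum.inr j₀))
        (by simp [hj, hreal, h0])
      simp only [map_sub, MvPolynomial.map_X, MvPolynomial.aeval_X, lvGens_inl, lvGens_zero_inr,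
        sub_eq_zero] at this
      rw [this, hreal, Literature.ModelTheory.ExponentialFields.Language.expRing.funMap_exp, h0']

/-- **The twisted Γ-isomorphisms over `σ` between tuples generating strong subspaces form a
back-and-forth system** for `L_exp = ⟨+, ·, -, 0, 1, exp⟩` (twisted port of
`GammaField.isBackAndForth_gammaIso_of_extension`), granted the one-point extension property for
`σ` (`hext`, forth) and for `σ⁻¹` (`hback`, back): related tuples satisfy the same atomic
formulas (`exists_state_realize_term_tw` and `IsGammaIsoTw.apply_eq_iff`), and every element can
be added on either side. -/
theorem isBackAndForth_gammaIsoTw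
    (hback : ∀ {N : ℕ} {c c' : Fin N → F}, IsGammaIsoTw σ.symm c c' →
      IsStrong (K₂ ⊔ Submodule.span ℚ (range c)) → IsStrong (K₁ ⊔ Submodule.span ℚ (range c')) →
      ∀ d : F, ∃ (k : ℕ) (e e' : Fin (k + 1) → F), e 0 = d ∧
        IsGammaIsoTw σ.symm (Fin.append c e) (Fin.append c' e') ∧
        IsStrong (K₂ ⊔ Submodule.span ℚ (range (Fin.append c e))) ∧
        IsStrong (K₁ ⊔ Submodule.span ℚ (range (Fin.append c' e'))))
    {α : Type*} (v v' : α → F) :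
    Language.expRing.IsBackAndForth v v' fun n (xs ys : Fin n → F) =>
      ∃ (N : ℕ) (c c' : Fin N → F), IsGammaIsoTw σ c c' ∧
        IsStrong (K₁ ⊔ Submodule.span ℚ (range c)) ∧ IsStrong (K₂ ⊔ Submodule.span ℚ (range c')) ∧
        (∀ i, ∃ j, c j = v i ∧ c' j = v' i) ∧ (∀ i, ∃ j, c j = xs i ∧ c' j = ys i) := by
  classical
  refine ⟨?_, ?_, ?_⟩
  · -- atomic formulas
    rintro n xs ys ⟨N, c, c', hiso, hs, hs', hv, hx⟩ φ hφ
    cases hφ with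
    | equal t₁ t₂ =>
      obtain ⟨N₁, c₁, c₁', hiso₁, hs₁, hs₁', hcov₁, j₁, hj₁, hj₁'⟩ :=
        exists_state_realize_term_tw hext t₁ hiso hs hs' hv hx
      have hv₁ : ∀ i, ∃ j, c₁ j = v i ∧ c₁' j = v' i := fun i => by
        obtain ⟨j, hj, hj'⟩ := hv i
        obtain ⟨j', h1, h1'⟩ := hcov₁ j
        exact ⟨j', h1.trans hj, h1'.trans hj'⟩
      have hx₁ : ∀ i, ∃ j, c₁ j = xs i ∧ c₁' j = ys i := fun i => by
        obtain ⟨j, hj, hj'⟩ := hx i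
        obtain ⟨j', h1, h1'⟩ := hcov₁ j
        exact ⟨j', h1.trans hj, h1'.trans hj'⟩
      obtain ⟨N₂, c₂, c₂', hiso₂, hs₂, hs₂', hcov₂, j₂, hj₂, hj₂'⟩ :=
        exists_state_realize_term_tw hext t₂ hiso₁ hs₁ hs₁' hv₁ hx₁
      obtain ⟨j₁', h1, h1'⟩ := hcov₂ j₁
      rw [BoundedFormula.realize_bdEqual, BoundedFormula.realize_bdEqual, ← hj₁, ← hj₁', ← h1,
        ← h1', ← hj₂, ← hj₂']
      exact hiso₂.apply_eq_iff j₁' j₂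
    | rel R ts => exact (show Empty from R).elim
  · -- forth
    rintro n xs ys ⟨N, c, c', hiso, hs, hs', hv, hx⟩ a
    obtain ⟨k, e, e', he0, hiso₁, hs₁, hs₁'⟩ := hext hiso hs hs' a
    refine ⟨e' 0, N + (k + 1), Fin.append c e, Fin.append c' e', hiso₁, hs₁, hs₁', fun i => ?_,
      fun i => ?_⟩
    · obtain ⟨j, hj, hj'⟩ := hv i
      exact ⟨Fin.castAdd (k + 1) j, by rw [Fin.append_left, hj], by rw [Fin.append_left, hj']⟩
    · refine Fin.lastCases ?_ (fun i => ?_) i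
      · refine ⟨Fin.natAdd N 0, ?_, ?_⟩
        · rw [Fin.append_right, he0, Fin.snoc_last]
        · rw [Fin.append_right, Fin.snoc_last]
      · obtain ⟨j, hj, hj'⟩ := hx i
        exact ⟨Fin.castAdd (k + 1) j, by rw [Fin.append_left, hj, Fin.snoc_castSucc],
          by rw [Fin.append_left, hj', Fin.snoc_castSucc]⟩
  · -- back (by symmetry)
    rintro n xs ys ⟨N, c, c', hiso, hs, hs', hv, hx⟩ b
    obtain ⟨k, e, e', he0, hiso₁, hs₁, hs₁'⟩ := hback hiso.symm hs' hs b
    have hiso₂ : IsGammaIsoTw σ (Fin.append c e') (Fin.append c' e) := by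
      have := hiso₁.symm
      rwa [RingEquiv.symm_symm] at this
    refine ⟨e' 0, N + (k + 1), Fin.append c e', Fin.append c' e, hiso₂, hs₁', hs₁, fun i => ?_,
      fun i => ?_⟩
    · obtain ⟨j, hj, hj'⟩ := hv i
      exact ⟨Fin.castAdd (k + 1) j, by rw [Fin.append_left, hj], by rw [Fin.append_left, hj']⟩
    · refine Fin.lastCases ?_ (fun i => ?_) i
      · refine ⟨Fin.natAdd N 0, ?_, ?_⟩
        · rw [Fin.append_right, Fin.snoc_last]
        · rw [Fin.append_right, he0, Fin.snoc_last]
      · obtain ⟨j, hj, hj'⟩ := hx i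
        exact ⟨Fin.castAdd (k + 1) j, by rw [Fin.append_left, hj, Fin.snoc_castSucc],
          by rw [Fin.append_left, hj', Fin.snoc_castSucc]⟩

end Karp

/-! ### The one-point extension property over `K = span ℚ (ecl ∅)` in `ℂ_exp`, under EAC -/

/-- **One-point extension of twisted Γ-isomorphisms over the core of `ℂ_exp`, under EAC.** Let
`K = span ℚ (ecl ∅) ≤ ℂ` (countable and Γ-closed) and `τ` an isomorphism of the base Γ-field `K⁰`
onto itself. If `c ↦ c'` is a Γ-isomorphism over `τ` with `K + ℚc ◁ ℂ`, `K + ℚc' ◁ ℂ`, then every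
`d` is the first coordinate of an extension `(c, e) ↦ (c', e')` with both sides strong: for `d`
exponentially algebraic over `K + ℚc` by `ZilberHomogeneity.exists_forth_tw` (twisted
`ℵ₀`-saturation from generic strong Γ-closedness over `K`, which EAC gives); for `d` generic by
`IsGammaIsoTw.append_singleton_of_not_mem`, the partner being any point outside the countable
Γ-closed `ecl (K ∪ c')` (`ℂ` is uncountable; countable closure property). -/
theorem exists_extension_tw_complex (hEAC : IsExpAlgClosed ℂ)
    {τ : fieldOf (Submodule.span ℚ (ecl (∅ : Set ℂ))) ≃+* fieldOf (Submodule.span ℚ (ecl (∅ : Set ℂ)))}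
    (hτ : IsEBaseIso (Submodule.span ℚ (ecl (∅ : Set ℂ))) (Submodule.span ℚ (ecl (∅ : Set ℂ))) τ)
    {N : ℕ} {c c' : Fin N → ℂ} (hiso : IsGammaIsoTw τ c c')
    (hs : IsStrong (Submodule.span ℚ (ecl (∅ : Set ℂ)) ⊔ Submodule.span ℚ (range c)))
    (hs' : IsStrong (Submodule.span ℚ (ecl (∅ : Set ℂ)) ⊔ Submodule.span ℚ (range c'))) (d : ℂ) :
    ∃ (k : ℕ) (e e' : Fin (k + 1) → ℂ), e 0 = d ∧
      IsGammaIsoTw τ (Fin.append c e) (Fin.append c' e') ∧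
      IsStrong (Submodule.span ℚ (ecl (∅ : Set ℂ)) ⊔ Submodule.span ℚ (range (Fin.append c e))) ∧
      IsStrong (Submodule.span ℚ (ecl (∅ : Set ℂ)) ⊔ Submodule.span ℚ (range (Fin.append c' e'))) := by
  classical
  set K : Submodule ℚ ℂ := Submodule.span ℚ (ecl (∅ : Set ℂ)) with hK
  have hccp : HasCountableClosureProperty ℂ := hasCountableClosureProperty_complex_holds
  have hKc : (K : Set ℂ).Countable := countable_span_ecl hccp countable_empty
  have hKΓ : IsGammaClosed K := isGammaClosed_span_ecl_of_countable hccp countable_empty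
  have hG : IsGenericallyStronglyGammaClosedOver K :=
    isGenericallyStronglyGammaClosedOver_complex_of_isExpAlgClosed hEAC hKΓ
  by_cases hd : d ∈ ecl ((K ⊔ Submodule.span ℚ (range c) : Submodule ℚ ℂ) : Set ℂ)
  · -- `d` exponentially algebraic over `K + ℚc`: twisted saturation
    set H : Submodule ℚ ℂ := Submodule.span ℚ (ecl (univ : Set ℂ)) with hH
    have hHΓ : IsGammaClosed H := isGammaClosed_span_ecl_univ _
    have hmemH : ∀ z : ℂ, z ∈ H := fun z => mem_span_ecl_iff.2 (subset_ecl _ (mem_univ z))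
    have hKH : K ≤ H := fun z _ => hmemH z
    obtain ⟨k, e, e', he0, hγ, hse, hse', -, -⟩ :=
      exists_forth_tw isSurjectiveOntoUnits_complex hτ hKΓ hG hHΓ hHΓ hKH hKH hiso hs hs'
        (fun i => hmemH _) (fun i => hmemH _) hd
    exact ⟨k, e, e', he0, hγ, hse, hse'⟩
  · -- `d` generic over `K + ℚc`: match with a generic point on the other side
    set H₁ : Submodule ℚ ℂ := Submodule.span ℚ (ecl ((K : Set ℂ) ∪ range c)) with hH₁
    set H₂ : Submodule ℚ ℂ := Submodule.span ℚ (ecl ((K : Set ℂ) ∪ range c')) with hH₂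
    have hH₁Γ : IsGammaClosed H₁ := isGammaClosed_span_ecl_univ _
    have hH₂Γ : IsGammaClosed H₂ := isGammaClosed_span_ecl_univ _
    have hle₁ : K ⊔ Submodule.span ℚ (range c) ≤ H₁ :=
      sup_le (fun x hx => subset_span_ecl _ (Or.inl hx))
        (Submodule.span_le.2 fun x hx => subset_span_ecl _ (Or.inr hx))
    have hle₂ : K ⊔ Submodule.span ℚ (range c') ≤ H₂ :=
      sup_le (fun x hx => subset_span_ecl _ (Or.inl hx))
        (Submodule.span_le.2 fun x hx => subset_span_ecl _ (Or.inr hx))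
    have hdH₁ : d ∉ H₁ := by
      intro hdH
      rw [hH₁, mem_span_ecl_iff] at hdH
      refine hd (ecl_mono ?_ hdH)
      rintro x (hx | hx)
      · exact Submodule.mem_sup_left hx
      · exact Submodule.mem_sup_right (Submodule.subset_span hx)
    have hH₂c : (H₂ : Set ℂ).Countable := countable_span_ecl hccp (hKc.union (countable_range c'))
    obtain ⟨d', hd'⟩ : ∃ d' : ℂ, d' ∉ H₂ := by
      by_contra! hall
      exact not_countable_complex (hH₂c.mono fun x _ => hall x)
    obtain ⟨hγ, hst₁, hst₂⟩ :=
      hiso.append_singleton_of_not_mem hs hs' hH₁Γ hH₂Γ hle₁ hle₂ hdH₁ hd'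
    exact ⟨0, ![d], ![d'], rfl, hγ, hst₁, hst₂⟩

/-- **Stub `stub_coreAut_elementary_of_eac` of line `eac-extends-core-automorphisms`** (crux
`RigidCore.AclSubsetLogFreeCore`, stmt-Schanuel-0968): under EAC, every exponential-field
automorphism `g` of the countable core `C₀ = ecl ∅` of `ℂ_exp` (tree presentation
`IsEIsoOn g (ecl ∅) (ecl ∅)`) preserves the trace on `C₀` of every `∅`-definable subset of
`(ℂ, +, ·, −, 0, 1, exp)`. Proof: Karp's lemma (`realize_iff_of_isBackAndForth`) for the
back-and-forth system `isBackAndForth_gammaIsoTw` of twisted Γ-isomorphisms over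
`σ = baseEquiv hg` (`isEBaseIso_baseEquiv`) between tuples spanning strong extensions of
`K = span ℚ (ecl ∅)`, with the one-point extension property `exists_extension_tw_complex` for
`σ` and `σ⁻¹`; the starting state covering `(a, g a)` is the extension of the empty state
(`isGammaIsoTw_elim0`) by the base constant `a ∈ K⁰`, whose partner is `σ a = g a`
(`IsGammaIsoTw.eq_of_eq_coe`, `coe_baseEquiv`); `s = φ(ℂ)`, `φ` parameter-free. -/
theorem stub_coreAut_elementary_of_eac :
    IsExpAlgClosed ℂ →
      ∀ g : ℂ → ℂ, IsEIsoOn g (ecl (∅ : Set ℂ)) (ecl (∅ : Set ℂ)) →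
        ∀ s : Set ℂ, Set.Definable₁ (∅ : Set ℂ) Language.expRing s →
          ∀ a ∈ ecl (∅ : Set ℂ), (a ∈ s ↔ g a ∈ s) := by
  classical
  intro hEAC g hg s hs a ha
  have hKΓ : IsGammaClosed (Submodule.span ℚ (ecl (∅ : Set ℂ))) :=
    isGammaClosed_span_ecl_of_countable hasCountableClosureProperty_complex_holds countable_empty
  -- the base isomorphism induced by `g`
  set σ := ZilberHomogeneity.baseEquiv hg with hσdef
  have hσ : IsEBaseIso (Submodule.span ℚ (ecl (∅ : Set ℂ))) (Submodule.span ℚ (ecl (∅ : Set ℂ))) σ :=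
    isEBaseIso_baseEquiv hg
  -- the back-and-forth system of twisted Γ-isomorphisms over `σ`
  have hBF := isBackAndForth_gammaIsoTw (σ := σ)
    (fun hiso hs₁ hs₁' d => exists_extension_tw_complex hEAC hσ hiso hs₁ hs₁' d)
    (fun hiso hs₁ hs₁' d => exists_extension_tw_complex hEAC hσ.symm hiso hs₁ hs₁' d)
    (fun _ : Fin 1 => a) (fun _ : Fin 1 => g a)
  -- the starting state: the empty state extended by the base constant `a`
  have hs₀ : IsStrong (Submodule.span ℚ (ecl (∅ : Set ℂ)) ⊔ Submodule.span ℚ (range (Fin.elim0 : Fin 0 → ℂ))) := by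
    rw [Set.range_eq_empty, Submodule.span_empty, sup_bot_eq]; exact hKΓ.isStrong
  obtain ⟨k, e, e', he, hiso, hs₁, hs₁'⟩ :=
    exists_extension_tw_complex hEAC hσ (isGammaIsoTw_elim0 σ) hs₀ hs₀ a
  have haF : a ∈ fieldOf (Submodule.span ℚ (ecl (∅ : Set ℂ))) :=
    (mem_fieldOf_span_ecl_iff (∅ : Set ℂ)).2 ha
  have hea : Fin.append Fin.elim0 e (Fin.natAdd 0 0) = a := by rw [Fin.append_right, he]
  have he'a : Fin.append Fin.elim0 e' (Fin.natAdd 0 0) = g a := by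
    have h1 : Fin.append Fin.elim0 e (Fin.natAdd 0 0) =
        ((⟨a, haF⟩ : fieldOf (Submodule.span ℚ (ecl (∅ : Set ℂ)))) : ℂ) := hea
    rw [hiso.eq_of_eq_coe h1, hσdef, coe_baseEquiv]
  -- Karp's lemma for a parameter-free defining formula of `s`
  obtain ⟨φ, hφ⟩ := Set.empty_definable_iff.1 hs
  have key : φ.Realize (fun _ : Fin 1 => a) ↔ φ.Realize (fun _ : Fin 1 => g a) :=
    FirstOrder.Language.realize_iff_of_isBackAndForth hBF φ
      ⟨0 + (k + 1), Fin.append Fin.elim0 e, Fin.append Fin.elim0 e', hiso, hs₁, hs₁',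
        fun _ => ⟨Fin.natAdd 0 0, hea, he'a⟩, fun i => i.elim0⟩
  have h1 := Set.ext_iff.1 hφ (fun _ : Fin 1 => a)
  have h2 := Set.ext_iff.1 hφ (fun _ : Fin 1 => g a)
  exact h1.trans (key.trans h2.symm)

end Summit.Schanuel.Schanuel.Theorems.RigidCore
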